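import Summits.HodgeConjecture.HodgeConjecture.Theorems.SmoothHypersurfaceGeometricGenus
import Summits.HodgeConjecture.HodgeConjecture.Theorems.SignSymmetricPowersFourFactsTorus

/-!
# Crux K1-B `VeryGeneralSignCommutatorsInHg` modulo THREE named facts {hPL, hCDK, hB2} — the genus binder removed

Prover seat `hodge-nonav-prover-Bx` (g11), cell `hodge-nonav`. The v16 skeleton of crux K1-B (stmt-HodgeConjecture-19716, line
`andre-zariski`) composes the crux from FOUR binders by
`SignSymmetricPowersFourFactsTorus.veryGeneralSignCommutatorsInHg_of_genusBound_three_facts hpg3 @hPL @hCDK @hB2`. The binder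
`hpg3` (`stub_genusBoundThreefold`: `h^{3,0}(X_f) ≤ C(d-1, 4)`) is now a TREE THEOREM
(`SmoothHypersurfaceGeometricGenus.stub_genusBoundThreefold`, from the proved named fact PG
`Arapura2012_hypersurface_geometricGenus_holds`), so the crux and its rung leaf follow from the THREE remaining named facts:
hPL = `picardLefschetz_nodalForms_uniform`, hCDK = `cmsp_nonHodgeGenericPoints_countable_algebraic_cover`,
hB2 = `picardLefschetz_symmetricA3`. CONDITIONAL on exactly these three (all published results stated as Literature `Prop`s);
sorry-free; no definition, no named fact introduced; `--supports stmt-HodgeConjecture-19716 --as helper`. Nothing here says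
HC ∕ HC_AV is proved; rung F-H1 is not moved by this file.
-/

set_option linter.dupNamespace false

namespace Summit.HodgeConjecture.HodgeConjecture.Theorems.SignSymmetricPowersThreeFacts

open Summit.HodgeConjecture.HodgeConjecture.Theorems.SignSymmetricPowersFourFactsTorus
  Summit.HodgeConjecture.HodgeConjecture.Theorems.SmoothHypersurfaceGeometricGenus

/-- **Crux K1-B `VeryGeneralSignCommutatorsInHg` modulo {hPL, hCDK, hB2}**: the v16 composition
`veryGeneralSignCommutatorsInHg_of_genusBound_three_facts` with its genus binder `hpg3` supplied by the tree theorem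
`SmoothHypersurfaceGeometricGenus.stub_genusBoundThreefold` (PG proved). CONDITIONAL on the three named facts.
[cite: Arapura2012, §17.3 (17.3.1)] [cite: CattaniDeligneKaplan1995, Thm. 1.1 and Cor. 1.2] -/
theorem veryGeneralSignCommutatorsInHg_of_three_facts
    (hPL : Literature.AlgebraicGeometry.HodgeTheory.picardLefschetz_nodalForms_uniform)
    (hCDK : Literature.AlgebraicGeometry.HodgeTheory.cmsp_nonHodgeGenericPoints_countable_algebraic_cover)
    (hB2 : Literature.AlgebraicGeometry.HodgeTheory.picardLefschetz_symmetricA3) :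
    Summit.HodgeConjecture.HodgeConjecture.Theses.SignSymmetricPowers.VeryGeneralSignCommutatorsInHg :=
  veryGeneralSignCommutatorsInHg_of_genusBound_three_facts stub_genusBoundThreefold @hPL @hCDK @hB2

/-- **The rung leaf `SignThreefoldPowersHodge` modulo {hPL, hCDK, hB2}** (`signThreefoldPowersHodge_of_genusBound_three_facts` with
`hpg3 := stub_genusBoundThreefold`). CONDITIONAL; rung F-H1 not moved. [cite: Arapura2012, §17.3 (17.3.1)]
[cite: CattaniDeligneKaplan1995, Thm. 1.1 and Cor. 1.2] -/
theorem signThreefoldPowersHodge_of_three_facts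
    (hPL : Literature.AlgebraicGeometry.HodgeTheory.picardLefschetz_nodalForms_uniform)
    (hCDK : Literature.AlgebraicGeometry.HodgeTheory.cmsp_nonHodgeGenericPoints_countable_algebraic_cover)
    (hB2 : Literature.AlgebraicGeometry.HodgeTheory.picardLefschetz_symmetricA3) :
    Summit.HodgeConjecture.HodgeConjecture.Theses.SignSymmetricPowers.SignThreefoldPowersHodge :=
  signThreefoldPowersHodge_of_genusBound_three_facts stub_genusBoundThreefold @hPL @hCDK @hB2

end Summit.HodgeConjecture.HodgeConjecture.Theorems.SignSymmetricPowersThreeFacts
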